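/-
Copyright (c) 2026. All rights reserved.
Released under Apache 2.0 license as described in the file LICENSE.
Authors: abc-iut cell, block F seat abc-iut-f-168 (gen 2).
-/
import Literature.AnabelianGeometry.SemiGraphs.TemperedCurvePuncturedDiscNonVacuity
import Literature.AnabelianGeometry.SemiGraphs.TemperedAbsolutenessReductionsConverse
import HarnessLib

/-!
# [SemiAnbd] Cor. 6.10 / Cor. 6.11: the hypothesis bundle of the conditional closers
# `temperedAbsolutenessHolds_of_laws` / `genusZeroTempAbsolutenessHolds_of_laws` is JOINTLY SATISFIABLE at a
# certificate certifying a CUSPED datum — and the closers fire there (non-vacuity of p433627)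

Mochizuki, *Semi-graphs of anabelioids*, Publ. RIMS **42** (2006) [SemiAnbd], Cor. 6.10 (Tempered
Absoluteness) and Cor. 6.11 (Unitwise and Integral Temp-absoluteness for Genus Zero), p. 77, over [Mzk8] §4
(Def. 4.1 (iv), Def. 4.8). [cite: MochizukiSemiAnbd2006, Cor 6.10 p.77]

PROOF-ONLY file (abc-iut cell, block F seat abc-iut-f-168 gen 2, self-named row «COR610-LAWS-NV»; no `def`,
no `instance`, nothing of the frozen interface `TemperedAbsoluteness.lean` restated).

CONTEXT.  abc-iut-f-168 gen 0 kernel-checked the printed proofs of Cor. 6.10 / 6.11 as CONDITIONAL closers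
(`TemperedAbsolutenessReductionsConverse.lean`, p433627): `AbsolutenessOrigin.temperedAbsolutenessHolds_of_laws :
h66 → h65 → hgood → hcpt → hrig → hnorm → hnormI → Ω.TemperedAbsolutenessHolds` (F-1656) and
`genusZeroTempAbsolutenessHolds_of_laws` (F-1655, `+ hCor411`), where `h66` = Thm. 6.6 (F-1707), `h65` =
Thm. 6.5 (iii) (F-1704) and the "laws" are properties of the genuine [Mzk8] §4 data that the typed records do
not carry.  A conditional closer whose antecedent were unsatisfiable at every certificate certifying a curve
would be worthless; this file shows it is not:

* `image_map_centerSplittings_eq`, `image_conjAct_smul_centerSplittings_eq` — the CENTRE-SPLITTINGS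
  `{S closed | S ⊓ Z(Π) = 1, S ⊔ Z(Π) = Π}` of a topological group are permuted by isomorphisms of topological
  groups and by conjugations; at a §6 datum of PUNCTURED-DISC TYPE (`TemperedCurvePuncturedDiscNonVacuity.lean`:
  `Π^temp = G_{ℚ_p} × Ẑ` compact, one `K`-rational cusp, `D_x = Π`, `I_x = Z(Π)` by `galoisMLF_slim_holds`) the
  [Mzk8] §4 splittings of `1 → I_x → D_x → G_K → 1` ARE the centre-splittings (`hatOf_splittings_of_disc`);
* `AbsolutenessOrigin.exists_cusped_certificate_laws` — **THE NON-VACUITY CERTIFICATE**: a certificate `Ω`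
  certifying the punctured-disc datum `X` (with a `K`-rational cusp), the ALL-SPLITTINGS canonical structures
  on it (canonical discrete = canonical integral `:=` all splittings — HONEST: the `O_K^×`- resp. `K^×`-torsor
  structures of [Mzk8] Def. 4.1 are not in the typed record), Kummer data with `H¹ ≅ ℤ` and PROPER unit image
  `2ℤ`, EVERY transport record, at which ALL EIGHT hypotheses `h66 h65 hgood hcpt hrig hnorm hnormI hCor411` of
  the gen-0 closers HOLD (`h65`: Thm. 6.5 (iii) at disc type; `h66`: compact regime; `hgood` and the unitwise
  clause of `hCor411`: the rigidity `Aut(ℤ) = {±1}`; `hcpt`: compactness; `hrig`: one cusp; `hnorm`/`hnormI` and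
  the integral clause of `hCor411`: centre-splittings transport) — AND CONSEQUENTLY `Ω.TemperedAbsolutenessHolds`
  (F-1656 as typed) and `Ω.GenusZeroTempAbsolutenessHolds` (F-1655 as typed), BY APPLYING THE GEN-0 CLOSERS.

HONEST LIMITS.  A toy: abelian `Δ^temp`, `D_x = Π^temp`, abstract Kummer/transport records (the typed records
carry no law), one closed point; binder-satisfiability evidence for p433627's closers and for the typing of
Cor. 6.10 / 6.11, not a model of a hyperbolic curve; the `∀Ω` closures of F-1655 / F-1656 remain REFUTED
(abc-iut-w6-d028).  Nothing printed is asserted; no side is taken on [IUTchIII] Cor. 3.12.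
-/

noncomputable section

namespace Literature.AnabelianGeometry.SemiGraphs

open scoped Pointwise

universe u v

/-! ### 1. Centre-splittings of a topological group: transport along isomorphisms and conjugations -/

section CenterSplittings

variable {G : Type u} {H : Type v} [Group G] [TopologicalSpace G] [Group H] [TopologicalSpace H]

omit [TopologicalSpace G] [TopologicalSpace H] in
/-- An isomorphism of groups carries the centre ONTO the centre (private copy). [folklore] -/
private theorem map_center_eq_center (e : G ≃* H) :
    (Subgroup.center G).map e.toMonoidHom = Subgroup.center H := by
  apply le_antisymm
  · rintro _ ⟨z, hz, rfl⟩
    rw [SetLike.mem_coe, Subgroup.mem_center_iff] at hz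
    refine Subgroup.mem_center_iff.2 fun h => ?_
    obtain ⟨g, rfl⟩ := e.surjective h
    change e g * e z = e z * e g
    rw [← map_mul, ← map_mul, hz g]
  · intro h hh
    refine ⟨e.symm h, ?_, e.apply_symm_apply h⟩
    rw [Subgroup.mem_center_iff] at hh
    rw [SetLike.mem_coe, Subgroup.mem_center_iff]
    refine fun g => e.injective ?_
    rw [map_mul, map_mul, e.apply_symm_apply]
    exact hh (e g)

/-- **Transport of centre-splittings along an isomorphism of topological groups**: if `S ⊆ G` is closed with
`S ∩ Z(G) = 1`, `S · Z(G) = G`, then so is `e(S) ⊆ H` — the splittings of `1 → I_x → D_x → G_K → 1`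
([Mzk8] §4 p. 33) at a cusp of punctured-disc type are such `S`. [cite: MochizukiSemiAnbd2006, §6 p.77] -/
theorem map_mem_centerSplittings (e : G ≃ₜ* H) {S : Subgroup G}
    (hS : IsClosed (S : Set G) ∧ S ⊓ Subgroup.center G = ⊥ ∧ S ⊔ Subgroup.center G = ⊤) :
    IsClosed ((S.map e.toMulEquiv.toMonoidHom : Subgroup H) : Set H) ∧
      S.map e.toMulEquiv.toMonoidHom ⊓ Subgroup.center H = ⊥ ∧
      S.map e.toMulEquiv.toMonoidHom ⊔ Subgroup.center H = ⊤ := by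
  obtain ⟨h1, h2, h3⟩ := hS
  refine ⟨?_, ?_, ?_⟩
  · rw [Subgroup.coe_map]
    exact e.toHomeomorph.isClosed_image.2 h1
  · rw [← map_center_eq_center e.toMulEquiv, ← Subgroup.map_inf_eq _ _ _ e.injective, h2,
      Subgroup.map_bot]
  · rw [← map_center_eq_center e.toMulEquiv, ← Subgroup.map_sup, h3,
      Subgroup.map_top_of_surjective _ e.surjective]

/-- The centre-splittings are carried ONTO the centre-splittings by an isomorphism of topological groups.
[cite: MochizukiSemiAnbd2006, §6 p.77] -/
theorem image_map_centerSplittings_eq (e : G ≃ₜ* H) :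
    (fun S : Subgroup G => S.map e.toMulEquiv.toMonoidHom) ''
        {S : Subgroup G | IsClosed (S : Set G) ∧ S ⊓ Subgroup.center G = ⊥ ∧ S ⊔ Subgroup.center G = ⊤} =
      {T : Subgroup H | IsClosed (T : Set H) ∧ T ⊓ Subgroup.center H = ⊥ ∧ T ⊔ Subgroup.center H = ⊤} := by
  apply le_antisymm
  · rintro _ ⟨S, hS, rfl⟩
    exact map_mem_centerSplittings e hS
  · intro T hT
    refine ⟨T.map e.symm.toMulEquiv.toMonoidHom, map_mem_centerSplittings e.symm hT, ?_⟩
    change (T.map e.toMulEquiv.symm.toMonoidHom).map e.toMulEquiv.toMonoidHom = T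
    rw [Subgroup.map_map]
    have hc : e.toMulEquiv.toMonoidHom.comp e.toMulEquiv.symm.toMonoidHom = MonoidHom.id H :=
      MonoidHom.ext fun x => e.toMulEquiv.apply_symm_apply x
    rw [hc, Subgroup.map_id]

variable [IsTopologicalGroup G]

/-- A conjugate of a closed subgroup is closed (private copy). [folklore] -/
private theorem isClosed_conjAct_smul {S : Subgroup G} (hS : IsClosed (S : Set G)) (γ : ConjAct G) :
    IsClosed ((γ • S : Subgroup G) : Set G) := by
  have h : ((γ • S : Subgroup G) : Set G) = (fun x : G => γ⁻¹ • x) ⁻¹' (S : Set G) := by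
    ext x
    rw [SetLike.mem_coe, Subgroup.mem_pointwise_smul_iff_inv_smul_mem]
    rfl
  rw [h]
  refine hS.preimage ?_
  simp only [ConjAct.smul_def]
  fun_prop

/-- The centre-splittings are carried ONTO the centre-splittings by every conjugation.
[cite: MochizukiSemiAnbd2006, §6 p.77] -/
theorem image_conjAct_smul_centerSplittings_eq (γ : ConjAct G) :
    (fun S : Subgroup G => γ • S) ''
        {S : Subgroup G | IsClosed (S : Set G) ∧ S ⊓ Subgroup.center G = ⊥ ∧ S ⊔ Subgroup.center G = ⊤} =
      {S : Subgroup G | IsClosed (S : Set G) ∧ S ⊓ Subgroup.center G = ⊥ ∧ S ⊔ Subgroup.center G = ⊤} := by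
  have hZ : ∀ δ : ConjAct G, δ • Subgroup.center G = Subgroup.center G := fun δ =>
    (inferInstance : (Subgroup.center G).Normal).conjAct δ
  have hmem : ∀ (δ : ConjAct G) (S : Subgroup G),
      IsClosed (S : Set G) ∧ S ⊓ Subgroup.center G = ⊥ ∧ S ⊔ Subgroup.center G = ⊤ →
        IsClosed ((δ • S : Subgroup G) : Set G) ∧ δ • S ⊓ Subgroup.center G = ⊥ ∧
          δ • S ⊔ Subgroup.center G = ⊤ := by
    rintro δ S ⟨h1, h2, h3⟩
    refine ⟨isClosed_conjAct_smul h1 δ, ?_, ?_⟩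
    · rw [← hZ δ, ← Subgroup.smul_inf, h2, Subgroup.smul_bot]
    · rw [← hZ δ, ← Subgroup.smul_sup, h3, (inferInstance : (⊤ : Subgroup G).Normal).conjAct δ]
  apply le_antisymm
  · rintro _ ⟨S, hS, rfl⟩
    exact hmem γ S hS
  · exact fun T hT => ⟨γ⁻¹ • T, hmem γ⁻¹ T hT, smul_inv_smul γ T⟩

end CenterSplittings

/-! ### 2. `Aut(ℤ) = {±1}`: every additive automorphism of `ℤ` fixes every subgroup -/

/-- Every additive automorphism of `ℤ` (namely `± id`) carries every subgroup onto itself. [folklore] -/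
private theorem addSubgroup_map_int_addEquiv (ψ : ℤ ≃+ ℤ) (U : AddSubgroup ℤ) :
    U.map ψ.toAddMonoidHom = U := by
  have hx : ∀ x : ℤ, ψ x = x * ψ 1 := fun x => by
    conv_lhs => rw [← mul_one x, ← smul_eq_mul]
    rw [map_zsmul, smul_eq_mul]
  have hu : ψ 1 = 1 ∨ ψ 1 = -1 := by
    refine Int.eq_one_or_neg_one_of_mul_eq_one (v := ψ.symm 1) ?_
    have h := ψ.apply_symm_apply 1
    rw [hx] at h
    rwa [mul_comm] at h
  ext y
  simp only [AddSubgroup.mem_map, AddEquiv.coe_toAddMonoidHom]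
  constructor
  · rintro ⟨x, hxU, rfl⟩
    rw [hx]
    rcases hu with h | h
    · rw [h, mul_one]; exact hxU
    · rw [h, mul_neg_one]; exact U.neg_mem hxU
  · intro hy
    rcases hu with h | h
    · exact ⟨y, hy, by rw [hx, h, mul_one]⟩
    · exact ⟨-y, U.neg_mem hy, by rw [hx, h, mul_neg_one, neg_neg]⟩

/-! ### 3. Punctured-disc type: `hatOf` of the set of all splittings -/

namespace TemperedCurve

variable {p : ℕ} [Fact p.Prime]

/-- At a cusp `x` of punctured-disc type (`D_x = Π^temp`, `I_x = Z(Π^temp)`) in the compact regime, the [Mzk8] §4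
splittings of `1 → I_x → D_x → G_K → 1` are the centre-splittings of `Π^temp`, and `hatOf` of the set of ALL
of them is the set of centre-splittings of `Π_{X_K}` (transport along the isomorphism `e` agreeing with
`ι : Π^temp → Π̂`; closed images, so no closure is needed). [cite: MochizukiSemiAnbd2006, §6 p.77] -/
theorem hatOf_splittings_of_disc (X : TemperedCurve p) [CompactSpace X.PiTemp]
    (e : X.PiTemp ≃ₜ* X.PiHat) (he : ∀ g, e g = X.toHat g) {x : X.Pt} (hD : X.decomp x = ⊤)
    (hI : X.inertia x = Subgroup.center X.PiTemp) :
    X.hatOf {S | X.IsSplittingSubgroup x S} =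
      {T : Subgroup X.PiHat | IsClosed (T : Set X.PiHat) ∧ T ⊓ Subgroup.center X.PiHat = ⊥ ∧
        T ⊔ Subgroup.center X.PiHat = ⊤} := by
  have hset : {S | X.IsSplittingSubgroup x S} =
      {S : Subgroup X.PiTemp | IsClosed (S : Set X.PiTemp) ∧ S ⊓ Subgroup.center X.PiTemp = ⊥ ∧
        S ⊔ Subgroup.center X.PiTemp = ⊤} := by
    ext S
    change IsClosed (S : Set X.PiTemp) ∧ S ≤ X.decomp x ∧ S ⊓ X.inertia x = ⊥ ∧
        S ⊔ X.inertia x = X.decomp x ↔ _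
    rw [hD, hI]
    exact ⟨fun h => ⟨h.1, h.2.2.1, h.2.2.2⟩, fun h => ⟨h.1, le_top, h.2.1, h.2.2⟩⟩
  have hφ : X.toHat.toMonoidHom = e.toMulEquiv.toMonoidHom := MonoidHom.ext fun g => (he g).symm
  have himg : X.hatOf {S | X.IsSplittingSubgroup x S} =
      (fun S => S.map e.toMulEquiv.toMonoidHom) '' {S | X.IsSplittingSubgroup x S} := by
    refine Set.image_congr fun S hS => ?_
    rw [hφ]
    have hcl : IsClosed ((S.map e.toMulEquiv.toMonoidHom : Subgroup X.PiHat) : Set X.PiHat) := by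
      rw [Subgroup.coe_map]
      exact e.toHomeomorph.isClosed_image.2 hS.1
    exact le_antisymm (Subgroup.topologicalClosure_minimal _ le_rfl hcl) (Subgroup.le_topologicalClosure _)
  rw [himg, hset]
  exact image_map_centerSplittings_eq e

end TemperedCurve

/-! ### 4. The non-vacuity certificate for the Cor. 6.10 / Cor. 6.11 closers -/

namespace AbsolutenessOrigin

/-- **NON-VACUITY OF THE COR. 6.10 / 6.11 CONDITIONAL CLOSERS (p433627) AT A CUSPED CERTIFICATE.**  There are an
`AbsolutenessOrigin` certificate `Ω`, a §6 datum `X` (punctured-disc type) with a `K`-RATIONAL CUSP, canonical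
structures `S` (all splittings; stable reduction flagged; nonempty at the cusp), a Kummer datum `k` (`H¹ := ℤ`,
unit image `2ℤ ≠ ⊤`) and flags `a`, ALL CERTIFIED by `Ω` (which certifies EVERY transport record), such that
ALL EIGHT hypotheses of abc-iut-f-168 gen 0's closers `temperedAbsolutenessHolds_of_laws` /
`genusZeroTempAbsolutenessHolds_of_laws` hold at `Ω` — `h66` (Thm. 6.6, F-1707), `h65` (Thm. 6.5 (iii), F-1704),
`hgood`, `hcpt`, `hrig`, `hnorm`, `hnormI`, `hCor411` ([Mzk8] Cor. 4.11, absolute form) — and hence, BY THOSE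
CLOSERS, `Ω.TemperedAbsolutenessHolds` (F-1656 as typed) and `Ω.GenusZeroTempAbsolutenessHolds` (F-1655 as
typed).  HONEST: toy datum (abelian `Δ^temp`, `D_x = Π^temp`, abstract Kummer records); binder-satisfiability
evidence, not an endorsement; the `∀Ω` closures stay refuted. [cite: MochizukiSemiAnbd2006, Cor 6.10 p.77] -/
theorem exists_cusped_certificate_laws (p : ℕ) [Fact p.Prime] :
    ∃ (Ω : AbsolutenessOrigin p) (X : TemperedCurve p) (S : CuspidalStructures X) (k : KummerUnitData X)
      (a : TemperedCurve.CurveArithmeticFlags X),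
      Ω.IsHyperbolicCurveOrigin X ∧ Ω.IsStructuresOrigin S ∧ Ω.IsKummerOrigin k ∧ Ω.IsFlagsOrigin a ∧
      (∃ x : X.Pt, X.IsCusp x ∧ X.IsRationalPt x) ∧ S.HasStableReduction ∧
      (∀ x, (S.canonicalIntegral x).Nonempty) ∧ k.unitImage ≠ ⊤ ∧
      (∀ (Y : TemperedCurve p) (kY : KummerUnitData Y) (t : KummerTransport k kY),
        Ω.IsKummerTransportOrigin t) ∧
      -- h66, h65
      Ω.toTemperedOrigin.ProfiniteOuterIsoLiftsHolds ∧ Ω.toTemperedOrigin.CuspidalAbsolutenessHolds ∧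
      -- hgood
      (∀ (X : TemperedCurve p) (kX : KummerUnitData X), Ω.IsHyperbolicCurveOrigin X →
        Ω.IsKummerOrigin kX → ∀ (Y : TemperedCurve p) (kY : KummerUnitData Y) (t : KummerTransport kX kY),
        Ω.IsHyperbolicCurveOrigin Y → Ω.IsKummerOrigin kY → Ω.IsKummerTransportOrigin t →
        ∀ (αhat : X.PiHat ≃ₜ* Y.PiHat) (β : X.PiTemp ≃ₜ* Y.PiTemp), TemperedCurve.LiesUnder X Y αhat β →
          (kX.unitImage).map (t.h1OfHat αhat).toAddMonoidHom =
            (kX.unitImage).map (t.h1OfTemp β).toAddMonoidHom) ∧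
      -- hcpt
      (∀ (Y : TemperedCurve p) (SY : CuspidalStructures Y), Ω.IsHyperbolicCurveOrigin Y →
        Ω.IsStructuresOrigin SY → ∀ (y : Y.Pt), Y.IsCusp y →
          ∀ T ∈ SY.canonicalDiscrete y, IsCompact (T : Set Y.PiTemp)) ∧
      -- hrig
      (∀ Y : TemperedCurve p, Ω.IsHyperbolicCurveOrigin Y → ∀ y y' : Y.Pt, Y.IsCusp y →
        Y.IsCusp y' → (∃ g : ConjAct Y.PiHat, Y.decompHat y' = g • Y.decompHat y) → y' = y) ∧
      -- hnorm
      (∀ (Y : TemperedCurve p) (SY : CuspidalStructures Y), Ω.IsHyperbolicCurveOrigin Y →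
        Ω.IsStructuresOrigin SY → ∀ y : Y.Pt, Y.IsCusp y → ∀ ε : ConjAct Y.PiHat,
          ε • Y.decompHat y = Y.decompHat y →
            (fun T => ε • T) '' Y.hatOf (SY.canonicalDiscrete y) = Y.hatOf (SY.canonicalDiscrete y)) ∧
      -- hnormI
      (∀ (Y : TemperedCurve p) (SY : CuspidalStructures Y), Ω.IsHyperbolicCurveOrigin Y →
        Ω.IsStructuresOrigin SY → ∀ y : Y.Pt, Y.IsCusp y → ∀ ε : ConjAct Y.PiHat,
          ε • Y.decompHat y = Y.decompHat y →
            (fun T => ε • T) '' Y.hatOf (SY.canonicalIntegral y) = Y.hatOf (SY.canonicalIntegral y)) ∧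
      -- hCor411 ([Mzk8] Cor. 4.11, absolute form, the extra binder of the Cor. 6.11 closer)
      (∀ (X : TemperedCurve p) (SX : CuspidalStructures X) (kX : KummerUnitData X)
        (aX : TemperedCurve.CurveArithmeticFlags X), Ω.IsHyperbolicCurveOrigin X →
        Ω.IsStructuresOrigin SX → Ω.IsKummerOrigin kX → Ω.IsFlagsOrigin aX →
        SX.HasStableReduction → aX.IsIsogenousToGenusZero →
          Ω.IsUnitwiseAbsolute kX ∧
            ∀ x : X.Pt, X.IsCusp x → X.IsRationalPt x → Ω.IsIntegrallyAbsoluteCusp SX x) ∧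
      -- hence, by the gen-0 closers:
      Ω.TemperedAbsolutenessHolds ∧ Ω.GenusZeroTempAbsolutenessHolds := by
  obtain ⟨X, -, -, hcpt, -, ⟨x₀⟩, hsub, hcusp, hrat, hD, hI, -, hspl⟩ :=
    TemperedCurve.exists_puncturedDisc p
  haveI := hcpt
  haveI := hsub
  haveI : T2Space X.PiHat := X.isProfiniteCompletion_toHat.t2Space
  obtain ⟨e, he⟩ := X.exists_continuousMulEquiv_eq_toHat
  let U : AddSubgroup ℤ := AddSubgroup.zmultiples (2 : ℤ)
  let Ω : AbsolutenessOrigin p :=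
    { IsHyperbolicCurveOrigin := fun Y => Y = X
      IsDomHomOrigin := fun _ => False
      IsDLocOrigin := fun _ => False
      IsFlagsOrigin := fun _ => True
      IsStructuresOrigin := fun {Y} SY =>
        ∀ y, SY.canonicalDiscrete y = {T | Y.IsSplittingSubgroup y T} ∧
          SY.canonicalIntegral y = {T | Y.IsSplittingSubgroup y T}
      IsKummerOrigin := fun {Y} kY => ∃ φ : kY.H1 ≃+ ℤ, kY.unitImage.map φ.toAddMonoidHom = U
      IsKummerTransportOrigin := fun _ => True
      IsCyclotomeOrigin := fun _ => False }
  let S : CuspidalStructures X :=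
    { HasStableReduction := True
      canonicalIntegral := fun x => {T | X.IsSplittingSubgroup x T}
      canonicalDiscrete := fun x => {T | X.IsSplittingSubgroup x T}
      canonicalIntegral_subset := fun _ => subset_rfl
      isSplitting_of_mem := fun _ _ _ _ hT => hT
      canonicalDiscrete_nonempty := fun x _ _ => hspl x
      canonicalIntegral_nonempty := fun _ x _ _ => hspl x }
  let k : KummerUnitData X := { H1 := ℤ, unitImage := U }
  let a : TemperedCurve.CurveArithmeticFlags X :=
    { IsOncePuncturedElliptic := False
      IsTorsionPt := fun _ => False
      IsIsogenousToGenusZero := True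
      IsAlgebraicPt := fun _ => False
      IsDefinedOverNumberField := False }
  have hU : U ≠ ⊤ := by
    intro h
    have h1 : (1 : ℤ) ∈ U := h ▸ AddSubgroup.mem_top _
    obtain ⟨n, hn⟩ := AddSubgroup.mem_zmultiples_iff.1 h1
    rw [zsmul_eq_mul] at hn
    omega
  -- RIGIDITY: any transport between certified Kummer data carries the unit image onto the unit image
  have hrigidK : ∀ {Y Y' : TemperedCurve p} (kY : KummerUnitData Y) (kY' : KummerUnitData Y'),
      Ω.IsKummerOrigin kY → Ω.IsKummerOrigin kY' → ∀ f : kY.H1 ≃+ kY'.H1,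
        kY.unitImage.map f.toAddMonoidHom = kY'.unitImage := by
    rintro Y Y' kY kY' ⟨φ, hφ⟩ ⟨φ', hφ'⟩ f
    have hback : ∀ {Z : TemperedCurve p} (kZ : KummerUnitData Z) (χ : kZ.H1 ≃+ ℤ),
        kZ.unitImage.map χ.toAddMonoidHom = U → kZ.unitImage = U.map χ.symm.toAddMonoidHom := by
      intro Z kZ χ hχ
      rw [← hχ, AddSubgroup.map_map]
      have hc : χ.symm.toAddMonoidHom.comp χ.toAddMonoidHom = AddMonoidHom.id _ :=
        AddMonoidHom.ext fun x => χ.symm_apply_apply x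
      rw [hc, AddSubgroup.map_id]
    have hcomp : f.toAddMonoidHom.comp φ.symm.toAddMonoidHom =
        φ'.symm.toAddMonoidHom.comp (φ.symm.trans (f.trans φ')).toAddMonoidHom := by
      ext
      simp
    rw [hback kY φ hφ, hback kY' φ' hφ', AddSubgroup.map_map, hcomp, ← AddSubgroup.map_map,
      addSubgroup_map_int_addEquiv (φ.symm.trans (f.trans φ')) U]
  -- `hatOf` of the all-splittings structure = centre-splittings of `Π̂` (stable under isos and conjugations)
  have hhat : ∀ x, X.hatOf {T | X.IsSplittingSubgroup x T} =
      {T : Subgroup X.PiHat | IsClosed (T : Set X.PiHat) ∧ T ⊓ Subgroup.center X.PiHat = ⊥ ∧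
        T ⊔ Subgroup.center X.PiHat = ⊤} := fun x => X.hatOf_splittings_of_disc e he (hD x) (hI x)
  -- the eight laws
  have h66 : Ω.toTemperedOrigin.ProfiniteOuterIsoLiftsHolds := by
    rintro Y Y' (rfl : Y = X) (rfl : Y' = Y)
    exact TemperedCurve.profiniteOuterIsoLifts_of_compactSpace _ _
  have h65 : Ω.toTemperedOrigin.CuspidalAbsolutenessHolds := by
    rintro Y Y' (rfl : Y = X) (rfl : Y' = Y)
    exact TemperedCurve.isoPreservesCuspidalDecomp_of_disc _ _ (fun x _ => ⟨hD x, hI x⟩) (hcusp x₀)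
      (hD x₀) (hI x₀)
  have hgood : ∀ (X : TemperedCurve p) (kX : KummerUnitData X), Ω.IsHyperbolicCurveOrigin X →
      Ω.IsKummerOrigin kX → ∀ (Y : TemperedCurve p) (kY : KummerUnitData Y) (t : KummerTransport kX kY),
      Ω.IsHyperbolicCurveOrigin Y → Ω.IsKummerOrigin kY → Ω.IsKummerTransportOrigin t →
      ∀ (αhat : X.PiHat ≃ₜ* Y.PiHat) (β : X.PiTemp ≃ₜ* Y.PiTemp), TemperedCurve.LiesUnder X Y αhat β →
        (kX.unitImage).map (t.h1OfHat αhat).toAddMonoidHom =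
          (kX.unitImage).map (t.h1OfTemp β).toAddMonoidHom := by
    intro Y kY _ hkY Y' kY' t _ hkY' _ αhat β _
    rw [hrigidK kY kY' hkY hkY' (t.h1OfHat αhat), hrigidK kY kY' hkY hkY' (t.h1OfTemp β)]
  have hcptL : ∀ (Y : TemperedCurve p) (SY : CuspidalStructures Y), Ω.IsHyperbolicCurveOrigin Y →
      Ω.IsStructuresOrigin SY → ∀ (y : Y.Pt), Y.IsCusp y →
        ∀ T ∈ SY.canonicalDiscrete y, IsCompact (T : Set Y.PiTemp) := by
    rintro Y SY (rfl : Y = X) hSY y _ T hT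
    rw [(hSY y).1] at hT
    exact hT.1.isCompact
  have hrigL : ∀ Y : TemperedCurve p, Ω.IsHyperbolicCurveOrigin Y → ∀ y y' : Y.Pt, Y.IsCusp y →
      Y.IsCusp y' → (∃ g : ConjAct Y.PiHat, Y.decompHat y' = g • Y.decompHat y) → y' = y := by
    rintro Y (rfl : Y = X) y y' _ _ _
    exact Subsingleton.elim _ _
  have hnormGen : ∀ (𝒯 : (Y : TemperedCurve p) → CuspidalStructures Y → Y.Pt → Set (Subgroup Y.PiTemp)),
      (∀ (Y : TemperedCurve p) (SY : CuspidalStructures Y), Ω.IsStructuresOrigin SY →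
        ∀ y, 𝒯 Y SY y = {T | Y.IsSplittingSubgroup y T}) →
      ∀ (Y : TemperedCurve p) (SY : CuspidalStructures Y), Ω.IsHyperbolicCurveOrigin Y →
        Ω.IsStructuresOrigin SY → ∀ y : Y.Pt, Y.IsCusp y → ∀ ε : ConjAct Y.PiHat,
          ε • Y.decompHat y = Y.decompHat y →
            (fun T => ε • T) '' Y.hatOf (𝒯 Y SY y) = Y.hatOf (𝒯 Y SY y) := by
    rintro 𝒯 h𝒯 Y SY (rfl : Y = X) hSY y _ ε _
    rw [h𝒯 Y SY hSY y, hhat y]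
    exact image_conjAct_smul_centerSplittings_eq ε
  have hnormL := hnormGen (fun Y SY y => SY.canonicalDiscrete y) fun Y SY hSY y => (hSY y).1
  have hnormIL := hnormGen (fun Y SY y => SY.canonicalIntegral y) fun Y SY hSY y => (hSY y).2
  have hCor411 : ∀ (X : TemperedCurve p) (SX : CuspidalStructures X) (kX : KummerUnitData X)
      (aX : TemperedCurve.CurveArithmeticFlags X), Ω.IsHyperbolicCurveOrigin X →
      Ω.IsStructuresOrigin SX → Ω.IsKummerOrigin kX → Ω.IsFlagsOrigin aX →
      SX.HasStableReduction → aX.IsIsogenousToGenusZero →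
        Ω.IsUnitwiseAbsolute kX ∧
          ∀ x : X.Pt, X.IsCusp x → X.IsRationalPt x → Ω.IsIntegrallyAbsoluteCusp SX x := by
    rintro Y SY kY aY (rfl : Y = X) hSY hkY _ _ _
    refine ⟨fun Y' kY' t _ hkY' _ αhat => hrigidK kY kY' hkY hkY' (t.h1OfHat αhat), ?_⟩
    rintro x - - Y' SY' (rfl : Y' = Y) hSY' αhat y γhat - -
    rw [(hSY x).2, (hSY' y).2, hhat x, hhat y, image_map_centerSplittings_eq αhat,
      image_conjAct_smul_centerSplittings_eq γhat]
  have hTA : Ω.TemperedAbsolutenessHolds :=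
    Ω.temperedAbsolutenessHolds_of_laws h66 h65 hgood hcptL hrigL hnormL hnormIL
  have hGZ : Ω.GenusZeroTempAbsolutenessHolds :=
    Ω.genusZeroTempAbsolutenessHolds_of_laws h66 h65 hgood hcptL hrigL hnormL hnormIL hCor411
  refine ⟨Ω, X, S, k, a, rfl, fun x => ⟨rfl, rfl⟩, ⟨AddEquiv.refl ℤ, ?_⟩, trivial,
    ⟨x₀, hcusp x₀, hrat x₀⟩, trivial, fun x => hspl x, hU, fun _ _ _ => trivial,
    h66, h65, hgood, hcptL, hrigL, hnormL, hnormIL, hCor411, hTA, hGZ⟩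
  change U.map (AddEquiv.refl ℤ).toAddMonoidHom = U
  exact addSubgroup_map_int_addEquiv _ U

end AbsolutenessOrigin

end Literature.AnabelianGeometry.SemiGraphs

end
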